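import Literature.Probability.Percolation.DecisionTreeWeighted
import Mathlib.Algebra.BigOperators.Group.Finset.Powerset
import Mathlib.Data.Fintype.BigOperators
import HarnessLib

/-!
# Two-configuration decision trees with `S`/`S̄` decisions and Gladkov's swap lemma in full
# (Gladkov 2024, Def. 2.4, Algorithm 1, Lemma 3.1 = Gladkov–Zimin 2024, Lemma 4.2)

Topic `Literature/Probability/Percolation`. Source: N. Gladkov, *Percolation Inequalities and Decision
Trees*, arXiv:2408.08457v2 (2024) [Gladkov2024], §2 Def. 2.4 and Algorithm 1 (pp. 3–4), Lemma 3.1 (p. 4):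
"Let `G` be finite. Let `S(C₁, C₂)` be built by some decision tree. Then `C₁ →_S C₂` is independent of
`C₂ →_S C₁ = C₁ →_S̄ C₂` and both are distributed as `μ`."  A decision tree (Def. 2.4): "each node
selects an edge, decides whether this edge goes to the set `S` or `S̄` and reveals it in both `C₁` and
`C₂`"; decision nodes "contain 4 links to descendants indexed by `{00, 01, 10, 11}`" and "the nodes on
every path from `N₀` should query pairwise distinct edges".

`DecisionTreeBK.lean` / `DecisionTreeWeighted.lean` formalise the SUB-class of trees reading `C₁` only and
sending every queried edge to `S` (there `S` is a self-determined function of `C₁` and the swap is an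
involution, `sum_pair_reindexW`).  This file adds the GENERAL class, for which the swap
`(C₁, C₂) ↦ (C₁ →_S C₂, C₂ →_S C₁)` is not an involution but still PRESERVES THE PRODUCT LAW.  All
PROVED, in the finitary weighted calculus (`wtW`, `wt2W`, `PrW`, `Pr2W` over configurations `⊆ D`; the
identity needs no sign hypothesis on `p`):

* `DTree2 ι`, `build2` (Algorithm 1: the set `S(C₁, C₂)`), `support2` (all queried edges), `Valid2`
  (no descendant re-queries an ancestor's edge), `swap2 T (C₁, C₂) = (C₁ →_S C₂, C₂ →_S C₁)`;
* **`sum_wt2W_comp_swap2`** — Lemma 3.1: for `T` valid with `support2 T ⊆ D` and every `f`,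
  `Σ_{x ∈ D.powerset²} wt2W x · f (swap2 T x) = Σ_x wt2W x · f x`; `Pr2W_preimage_swap2` (pushforward
  form) and `Pr2W_swap2_mem_prod` — "`C₁ →_S C₂`, `C₂ →_S C₁` independent, each with law `μ`".

Proof (as [GZ24, Lemma 4.2]): induction on the tree; at a node querying `e ∈ D` split the pair space
along `e` (`sum_pairs_split`: `Finset.sum_powerset_insert` twice, `wtW D (ins e b R) = wt1 e b ·
wtW (D.erase e) R`); the children do not query `e` (`Valid2`), so on each of the four blocks the swap
is the child's swap on `D.erase e` with the `e`-bits put back (`swap2_node_ins`) — unchanged for an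
`S`-decision, exchanged for an `S̄`-decision, which the symmetry `b₁ ↔ b₂` of `w(b₁) w(b₂)` absorbs.
Not here: Thms 3.2/4.3 for this general class (in the tree for `C₁`-reading all-`S` trees).
-/

noncomputable section

open Classical

namespace Literature.Probability.Percolation

namespace DecisionTree

open Finset

variable {ι : Type*} [DecidableEq ι]

/-! ### Two-configuration trees (Def. 2.4) and the set they build (Algorithm 1) -/

/-- A decision tree reading two configurations: a leaf, or a node querying the edge `e` in both
configurations, sending `e` to `S` iff `toS`, with four children indexed by the pair of values
`(C₁ e, C₂ e) ∈ {11, 10, 01, 00}`. [cite: Gladkov2024, Def. 2.4] -/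
inductive DTree2 (ι : Type*) : Type _
  | leaf : DTree2 ι
  | node (e : ι) (toS : Bool) (c11 c10 c01 c00 : DTree2 ι) : DTree2 ι

namespace DTree2

/-- The child followed on the pair of values `(b₁, b₂)`. [cite: Gladkov2024, Algorithm 1 (lines 8–16)] -/
def child (c11 c10 c01 c00 : DTree2 ι) : Bool → Bool → DTree2 ι
  | true, true => c11
  | true, false => c10
  | false, true => c01
  | false, false => c00

/-- The set `S(C₁, C₂)` built by the tree (Algorithm 1). [cite: Gladkov2024, Algorithm 1] -/
def build2 : DTree2 ι → Finset ι → Finset ι → Finset ι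
  | leaf, _, _ => ∅
  | node e toS c11 c10 c01 c00, C₁, C₂ =>
      let S' := if e ∈ C₁ then (if e ∈ C₂ then build2 c11 C₁ C₂ else build2 c10 C₁ C₂)
        else (if e ∈ C₂ then build2 c01 C₁ C₂ else build2 c00 C₁ C₂)
      if toS then insert e S' else S'

/-- All edges queried anywhere in the tree. [cite: Gladkov2024, Def. 2.4] -/
def support2 : DTree2 ι → Finset ι
  | leaf => ∅
  | node e _ c11 c10 c01 c00 => insert e (support2 c11 ∪ support2 c10 ∪ support2 c01 ∪ support2 c00)

/-- Gladkov's well-formedness condition "the nodes on every path from the root query pairwise distinct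
edges": no descendant of a node re-queries the node's edge. [cite: Gladkov2024, Def. 2.4] -/
def Valid2 : DTree2 ι → Prop
  | leaf => True
  | node e _ c11 c10 c01 c00 =>
      (e ∉ support2 c11 ∧ e ∉ support2 c10 ∧ e ∉ support2 c01 ∧ e ∉ support2 c00) ∧
        (Valid2 c11 ∧ Valid2 c10 ∧ Valid2 c01 ∧ Valid2 c00)

/-- The swap along the built set: `(C₁, C₂) ↦ (C₁ →_S C₂, C₂ →_S C₁)`, `S = S(C₁, C₂)`.
[cite: Gladkov2024, Lemma 3.1] -/
def swap2 (T : DTree2 ι) (x : Finset ι × Finset ι) : Finset ι × Finset ι :=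
  (splice (build2 T x.1 x.2) x.1 x.2, splice (build2 T x.1 x.2) x.2 x.1)

/-! ### Basic facts -/
/-- `build2` at a node, through `child`. [cite: Gladkov2024, Algorithm 1] -/
theorem build2_node (e : ι) (toS : Bool) (c11 c10 c01 c00 : DTree2 ι) (C₁ C₂ : Finset ι) :
    build2 (node e toS c11 c10 c01 c00) C₁ C₂ =
      (if toS then insert e (build2 (child c11 c10 c01 c00 (decide (e ∈ C₁)) (decide (e ∈ C₂))) C₁ C₂)
        else build2 (child c11 c10 c01 c00 (decide (e ∈ C₁)) (decide (e ∈ C₂))) C₁ C₂) := by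
  by_cases h₁ : e ∈ C₁ <;> by_cases h₂ : e ∈ C₂ <;> simp [build2, child, h₁, h₂]

/-- The support of a child lies in the support of the node. [folklore] -/
theorem support2_child_subset (e : ι) (toS : Bool) (c11 c10 c01 c00 : DTree2 ι) (b₁ b₂ : Bool) :
    support2 (child c11 c10 c01 c00 b₁ b₂) ⊆ support2 (node e toS c11 c10 c01 c00) := by
  intro i hi
  have h : i ∈ support2 c11 ∪ support2 c10 ∪ support2 c01 ∪ support2 c00 := by
    simp only [mem_union]
    cases b₁ <;> cases b₂
    · exact Or.inr hi
    · exact Or.inl (Or.inr hi)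
    · exact Or.inl (Or.inl (Or.inr hi))
    · exact Or.inl (Or.inl (Or.inl hi))
  exact mem_insert_of_mem h

/-- A valid node's children are valid and do not query the node's edge. [folklore] -/
theorem valid2_child {e : ι} {toS : Bool} {c11 c10 c01 c00 : DTree2 ι}
    (h : Valid2 (node e toS c11 c10 c01 c00)) (b₁ b₂ : Bool) :
    Valid2 (child c11 c10 c01 c00 b₁ b₂) ∧ e ∉ support2 (child c11 c10 c01 c00 b₁ b₂) := by
  obtain ⟨⟨h11, h10, h01, h00⟩, v11, v10, v01, v00⟩ := h
  cases b₁ <;> cases b₂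
  · exact ⟨v00, h00⟩
  · exact ⟨v01, h01⟩
  · exact ⟨v10, h10⟩
  · exact ⟨v11, h11⟩

/-- The built set lies in the support. [folklore] -/
theorem build2_subset_support2 : ∀ (T : DTree2 ι) (C₁ C₂ : Finset ι), build2 T C₁ C₂ ⊆ support2 T
  | leaf, _, _ => by simp [build2]
  | node e toS c11 c10 c01 c00, C₁, C₂ => by
      rw [build2_node]
      have hsub := support2_child_subset e toS c11 c10 c01 c00 (decide (e ∈ C₁)) (decide (e ∈ C₂))
      have ih : build2 (child c11 c10 c01 c00 (decide (e ∈ C₁)) (decide (e ∈ C₂))) C₁ C₂ ⊆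
          support2 (child c11 c10 c01 c00 (decide (e ∈ C₁)) (decide (e ∈ C₂))) := by
        cases decide (e ∈ C₁) <;> cases decide (e ∈ C₂)
        · exact build2_subset_support2 c00 C₁ C₂
        · exact build2_subset_support2 c01 C₁ C₂
        · exact build2_subset_support2 c10 C₁ C₂
        · exact build2_subset_support2 c11 C₁ C₂
      intro i hi
      split_ifs at hi with ht
      · rcases mem_insert.1 hi with rfl | hi
        · simp [support2]
        · exact hsub (ih hi)
      · exact hsub (ih hi)

/-- The built set depends on the configurations only through the coordinates in the support.
[cite: Gladkov2024, §2 ("each node can make a decision based only on the edges revealed so far")] -/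
theorem build2_congr : ∀ (T : DTree2 ι) {C₁ C₁' C₂ C₂' : Finset ι},
    (∀ i ∈ support2 T, (i ∈ C₁ ↔ i ∈ C₁')) → (∀ i ∈ support2 T, (i ∈ C₂ ↔ i ∈ C₂')) →
      build2 T C₁ C₂ = build2 T C₁' C₂'
  | leaf, _, _, _, _, _, _ => by simp [build2]
  | node e toS c11 c10 c01 c00, C₁, C₁', C₂, C₂', h₁, h₂ => by
      have he : e ∈ support2 (node e toS c11 c10 c01 c00) := by simp [support2]
      have hs11 := support2_child_subset e toS c11 c10 c01 c00 true true
      have hs10 := support2_child_subset e toS c11 c10 c01 c00 true false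
      have hs01 := support2_child_subset e toS c11 c10 c01 c00 false true
      have hs00 := support2_child_subset e toS c11 c10 c01 c00 false false
      simp only [child] at hs11 hs10 hs01 hs00
      have i11 := build2_congr c11 (fun i hi => h₁ i (hs11 hi)) (fun i hi => h₂ i (hs11 hi))
      have i10 := build2_congr c10 (fun i hi => h₁ i (hs10 hi)) (fun i hi => h₂ i (hs10 hi))
      have i01 := build2_congr c01 (fun i hi => h₁ i (hs01 hi)) (fun i hi => h₂ i (hs01 hi))
      have i00 := build2_congr c00 (fun i hi => h₁ i (hs00 hi)) (fun i hi => h₂ i (hs00 hi))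
      have e₁ : (e ∈ C₁) = (e ∈ C₁') := propext (h₁ e he)
      have e₂ : (e ∈ C₂) = (e ∈ C₂') := propext (h₂ e he)
      simp only [build2, i11, i10, i01, i00, e₁, e₂]

/-! ### Splitting the pair space along one coordinate -/
section Split

variable (D : Finset ι) (p : ι → ℝ)

/-- Insert the coordinate `e` or not, according to a Boolean. [folklore] -/
def ins (e : ι) (b : Bool) (R : Finset ι) : Finset ι := if b then insert e R else R

/-- The one-coordinate Bernoulli weight of a bit. [folklore] -/
def wt1 (e : ι) (b : Bool) : ℝ := if b then p e else 1 - p e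

/-- Membership in `ins`. [folklore] -/
theorem mem_ins {e : ι} {b : Bool} {R : Finset ι} {i : ι} :
    i ∈ ins e b R ↔ (i = e ∧ b = true) ∨ i ∈ R := by
  unfold ins; cases b <;> simp

/-- `e ∈ ins e b R ↔ b` when `e ∉ R`. [folklore] -/
theorem mem_ins_self_iff {e : ι} {b : Bool} {R : Finset ι} (he : e ∉ R) : e ∈ ins e b R ↔ b = true := by
  rw [mem_ins]; simp [he]

/-- Off `e`, `ins e b R` agrees with `R`. [folklore] -/
theorem mem_ins_of_ne {e : ι} {b : Bool} {R : Finset ι} {i : ι} (hi : i ≠ e) : i ∈ ins e b R ↔ i ∈ R := by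
  rw [mem_ins]; simp [hi]

/-- Weight factorisation along the coordinate `e ∈ D`: `wtW D (ins e b R) = wt1 e b · wtW (D.erase e) R`
for `R ⊆ D.erase e`. [folklore] -/
theorem wtW_ins {e : ι} (he : e ∈ D) (b : Bool) {R : Finset ι} (hR : R ⊆ D.erase e) :
    wtW D p (ins e b R) = wt1 p e b * wtW (D.erase e) p R := by
  have heR : e ∉ R := fun h => (mem_erase.1 (hR h)).1 rfl
  unfold wtW
  rw [← insert_erase he, prod_insert (notMem_erase e D), insert_erase he]
  congr 1
  · unfold wt1
    cases b
    · rw [if_neg ((mem_ins_self_iff heR).not.2 (by simp))]; simp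
    · rw [if_pos ((mem_ins_self_iff heR).2 rfl)]; simp
  · refine prod_congr rfl fun i hi => ?_
    have hie : i ≠ e := (mem_erase.1 hi).1
    by_cases hiR : i ∈ R
    · rw [if_pos ((mem_ins_of_ne hie).2 hiR), if_pos hiR]
    · rw [if_neg (fun h => hiR ((mem_ins_of_ne hie).1 h)), if_neg hiR]

/-- Splitting a sum over `D.powerset` along `e ∈ D`. [folklore] -/
theorem sum_powerset_split {β : Type*} [AddCommMonoid β] {e : ι} (he : e ∈ D) (F : Finset ι → β) :
    ∑ S ∈ D.powerset, F S = ∑ b : Bool, ∑ R ∈ (D.erase e).powerset, F (ins e b R) := by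
  conv_lhs => rw [← insert_erase he]
  rw [sum_powerset_insert (notMem_erase e D), Fintype.sum_bool]
  simp only [ins, if_true, Bool.false_eq_true, if_false]
  rw [add_comm]

/-- Splitting a sum over the pair space along `e ∈ D`, with the weights factorised. [folklore] -/
theorem sum_pairs_split {e : ι} (he : e ∈ D) (F : Finset ι × Finset ι → ℝ) :
    ∑ x ∈ D.powerset ×ˢ D.powerset, wt2W D p x * F x =
      ∑ b₁ : Bool, ∑ b₂ : Bool, wt1 p e b₁ * wt1 p e b₂ *
        ∑ y ∈ (D.erase e).powerset ×ˢ (D.erase e).powerset,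
          wt2W (D.erase e) p y * F (ins e b₁ y.1, ins e b₂ y.2) := by
  rw [sum_product, sum_powerset_split D he]
  refine sum_congr rfl fun b₁ _ => ?_
  have inner : ∀ R₁ ∈ (D.erase e).powerset,
      ∑ C₂ ∈ D.powerset, wt2W D p (ins e b₁ R₁, C₂) * F (ins e b₁ R₁, C₂) =
        ∑ b₂ : Bool, ∑ R₂ ∈ (D.erase e).powerset,
          wt1 p e b₁ * wt1 p e b₂ * (wt2W (D.erase e) p (R₁, R₂) * F (ins e b₁ R₁, ins e b₂ R₂)) := by
    intro R₁ hR₁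
    rw [sum_powerset_split D he]
    refine sum_congr rfl fun b₂ _ => sum_congr rfl fun R₂ hR₂ => ?_
    rw [mem_powerset] at hR₁ hR₂
    simp only [wt2W, wtW_ins D p he b₁ hR₁, wtW_ins D p he b₂ hR₂]
    ring
  rw [sum_congr rfl inner, sum_comm]
  refine sum_congr rfl fun b₂ _ => ?_
  rw [sum_product, mul_sum]
  refine sum_congr rfl fun R₁ _ => ?_
  rw [mul_sum]

end Split

/-! ### Lemma 3.1: the swap preserves the product law -/
section Swap

variable (p : ι → ℝ)

/-- At a leaf the swap exchanges the two configurations. [folklore] -/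
theorem swap2_leaf (x : Finset ι × Finset ι) : swap2 (leaf : DTree2 ι) x = (x.2, x.1) := by
  unfold swap2
  simp only [build2]
  ext i <;> simp [mem_splice]

/-- Splicing along `insert e S'` of configurations split at `e`: the `e`-bit comes from the FIRST
configuration. [folklore] -/
theorem splice_insert_ins {e : ι} {S' R₁ R₂ : Finset ι} (hS : e ∉ S') (h₁ : e ∉ R₁) (h₂ : e ∉ R₂)
    (b₁ b₂ : Bool) :
    splice (insert e S') (ins e b₁ R₁) (ins e b₂ R₂) = ins e b₁ (splice S' R₁ R₂) := by
  ext i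
  by_cases hie : i = e
  · subst hie
    simp [mem_splice, mem_ins, hS, h₁, h₂]
  · simp only [mem_splice, mem_insert, hie, false_or, mem_ins, false_and]

/-- Splicing along `S' ∌ e` of configurations split at `e`: the `e`-bit comes from the SECOND
configuration. [folklore] -/
theorem splice_ins_of_not_mem {e : ι} {S' R₁ R₂ : Finset ι} (hS : e ∉ S') (h₁ : e ∉ R₁) (h₂ : e ∉ R₂)
    (b₁ b₂ : Bool) :
    splice S' (ins e b₁ R₁) (ins e b₂ R₂) = ins e b₂ (splice S' R₁ R₂) := by
  ext i
  by_cases hie : i = e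
  · subst hie
    simp only [mem_splice, hS, false_and, not_false_eq_true, true_and, false_or, mem_ins, h₁, h₂,
      or_false]
  · simp only [mem_splice, hie, mem_ins, false_and, false_or]

/-- On the block `(C₁ e, C₂ e) = (b₁, b₂)` of a valid node querying `e`, the swap is the child's swap
with the `e`-bits put back — unchanged for an `S`-decision, exchanged for an `S̄`-decision.
[cite: Gladkov2024, proof of Lemma 3.1 / GZ24 Lemma 4.2] -/
theorem swap2_node_ins {e : ι} {toS : Bool} {c11 c10 c01 c00 : DTree2 ι}
    (hV : Valid2 (node e toS c11 c10 c01 c00)) (b₁ b₂ : Bool) {R₁ R₂ : Finset ι}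
    (hR₁ : e ∉ R₁) (hR₂ : e ∉ R₂) :
    swap2 (node e toS c11 c10 c01 c00) (ins e b₁ R₁, ins e b₂ R₂) =
      (ins e (if toS then b₁ else b₂) (swap2 (child c11 c10 c01 c00 b₁ b₂) (R₁, R₂)).1,
       ins e (if toS then b₂ else b₁) (swap2 (child c11 c10 c01 c00 b₁ b₂) (R₁, R₂)).2) := by
  obtain ⟨-, hec⟩ := valid2_child hV b₁ b₂
  set c := child c11 c10 c01 c00 b₁ b₂ with hc
  have hd₁ : decide (e ∈ ins e b₁ R₁) = b₁ := by
    cases b₁ <;> simp [mem_ins_self_iff hR₁]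
  have hd₂ : decide (e ∈ ins e b₂ R₂) = b₂ := by
    cases b₂ <;> simp [mem_ins_self_iff hR₂]
  have hS' : build2 c (ins e b₁ R₁) (ins e b₂ R₂) = build2 c R₁ R₂ :=
    build2_congr c (fun i hi => mem_ins_of_ne (fun h => hec (h ▸ hi)))
      (fun i hi => mem_ins_of_ne (fun h => hec (h ▸ hi)))
  have heS' : e ∉ build2 c R₁ R₂ := fun h => hec (build2_subset_support2 c R₁ R₂ h)
  have hbuild : build2 (node e toS c11 c10 c01 c00) (ins e b₁ R₁) (ins e b₂ R₂) =
      if toS then insert e (build2 c R₁ R₂) else build2 c R₁ R₂ := by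
    rw [build2_node, hd₁, hd₂, ← hc, hS']
  unfold swap2
  rw [hbuild]
  cases toS
  · simp only [Bool.false_eq_true, if_false]
    rw [splice_ins_of_not_mem heS' hR₁ hR₂, splice_ins_of_not_mem heS' hR₂ hR₁]
  · simp only [if_true]
    rw [splice_insert_ins heS' hR₁ hR₂, splice_insert_ins heS' hR₂ hR₁]

omit [DecidableEq ι] in
/-- The four children satisfy a property as soon as each does. [folklore] -/
theorem forall_child {P : DTree2 ι → Prop} {c11 c10 c01 c00 : DTree2 ι}
    (h11 : P c11) (h10 : P c10) (h01 : P c01) (h00 : P c00) (b₁ b₂ : Bool) :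
    P (child c11 c10 c01 c00 b₁ b₂) := by
  cases b₁ <;> cases b₂
  · exact h00
  · exact h01
  · exact h10
  · exact h11

/-- **Gladkov's Lemma 3.1 (= Gladkov–Zimin Lemma 4.2), finitary pushforward form.**  For a valid
two-configuration tree `T` querying edges of `D` and every function `f` of a pair of configurations,
`Σ_{x ∈ D.powerset²} wt2W x · f (swap2 T x) = Σ_x wt2W x · f x`: the pair
`(C₁ →_S C₂, C₂ →_S C₁)` has the law of `(C₁, C₂)`. [cite: Gladkov2024, Lemma 3.1] -/
theorem sum_wt2W_comp_swap2 (T : DTree2 ι) (hV : Valid2 T) (D : Finset ι) (hD : support2 T ⊆ D)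
    (f : Finset ι × Finset ι → ℝ) :
    ∑ x ∈ D.powerset ×ˢ D.powerset, wt2W D p x * f (swap2 T x) =
      ∑ x ∈ D.powerset ×ˢ D.powerset, wt2W D p x * f x := by
  induction T generalizing D f with
  | leaf =>
      simp only [swap2_leaf]
      refine sum_nbij' (fun x => (x.2, x.1)) (fun x => (x.2, x.1)) ?_ ?_ (fun _ _ => rfl) (fun _ _ => rfl) ?_
      · intro x hx; rw [mem_product] at hx ⊢; exact ⟨hx.2, hx.1⟩
      · intro x hx; rw [mem_product] at hx ⊢; exact ⟨hx.2, hx.1⟩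
      · intro x _; simp only [wt2W]; ring
  | node e toS c11 c10 c01 c00 ih11 ih10 ih01 ih00 =>
      have he : e ∈ D := hD (by simp [support2])
      rw [sum_pairs_split D p he, sum_pairs_split D p he]
      have hblock : ∀ b₁ b₂ : Bool,
          ∑ y ∈ (D.erase e).powerset ×ˢ (D.erase e).powerset, wt2W (D.erase e) p y *
              f (swap2 (node e toS c11 c10 c01 c00) (ins e b₁ y.1, ins e b₂ y.2)) =
            ∑ y ∈ (D.erase e).powerset ×ˢ (D.erase e).powerset, wt2W (D.erase e) p y *
              f (ins e (if toS then b₁ else b₂) y.1, ins e (if toS then b₂ else b₁) y.2) := by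
        intro b₁ b₂
        obtain ⟨hvc, hec⟩ := valid2_child hV b₁ b₂
        have hDc : support2 (child c11 c10 c01 c00 b₁ b₂) ⊆ D.erase e := by
          intro i hi
          exact mem_erase.2 ⟨fun h => hec (h ▸ hi),
            hD (support2_child_subset e toS c11 c10 c01 c00 b₁ b₂ hi)⟩
        have ih : ∀ (g : Finset ι × Finset ι → ℝ),
            ∑ y ∈ (D.erase e).powerset ×ˢ (D.erase e).powerset, wt2W (D.erase e) p y *
                g (swap2 (child c11 c10 c01 c00 b₁ b₂) y) =
              ∑ y ∈ (D.erase e).powerset ×ˢ (D.erase e).powerset, wt2W (D.erase e) p y * g y :=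
          fun g => forall_child (P := fun T => Valid2 T → support2 T ⊆ D.erase e →
              ∀ g : Finset ι × Finset ι → ℝ,
                ∑ y ∈ (D.erase e).powerset ×ˢ (D.erase e).powerset, wt2W (D.erase e) p y * g (swap2 T y) =
                  ∑ y ∈ (D.erase e).powerset ×ˢ (D.erase e).powerset, wt2W (D.erase e) p y * g y)
            (fun hv hd => ih11 hv (D.erase e) hd) (fun hv hd => ih10 hv (D.erase e) hd)
            (fun hv hd => ih01 hv (D.erase e) hd) (fun hv hd => ih00 hv (D.erase e) hd) b₁ b₂ hvc hDc g
        rw [← ih (fun y => f (ins e (if toS then b₁ else b₂) y.1, ins e (if toS then b₂ else b₁) y.2))]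
        refine sum_congr rfl fun y hy => ?_
        rw [mem_product, mem_powerset, mem_powerset] at hy
        have hR₁ : e ∉ y.1 := fun h => (mem_erase.1 (hy.1 h)).1 rfl
        have hR₂ : e ∉ y.2 := fun h => (mem_erase.1 (hy.2 h)).1 rfl
        rw [swap2_node_ins hV b₁ b₂ hR₁ hR₂]
      simp only [hblock]
      cases toS
      · simp only [Bool.false_eq_true, if_false, Fintype.sum_bool]
        ring
      · simp only [if_true]

/-- `Pr2W` is invariant under the swap of a valid tree (pushforward form of Lemma 3.1).
[cite: Gladkov2024, Lemma 3.1] -/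
theorem Pr2W_preimage_swap2 {T : DTree2 ι} (hV : Valid2 T) {D : Finset ι} (hD : support2 T ⊆ D)
    (Y : Set (Finset ι × Finset ι)) :
    Pr2W D p {x | swap2 T x ∈ Y} = Pr2W D p Y := by
  rw [Pr2W_eq_sum_ind, Pr2W_eq_sum_ind]
  have h := sum_wt2W_comp_swap2 p T hV D hD (ind Y)
  refine Eq.trans (sum_congr rfl fun x _ => ?_) h
  by_cases hx : swap2 T x ∈ Y
  · rw [ind_of_mem hx, ind_of_mem (show x ∈ {x | swap2 T x ∈ Y} from hx)]
  · rw [ind_of_not_mem hx, ind_of_not_mem (show x ∉ {x | swap2 T x ∈ Y} from hx)]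

/-- **Lemma 3.1 as printed**: `C₁ →_S C₂` and `C₂ →_S C₁` are independent and each has law `μ`:
`P⊗P{(C₁ →_S C₂) ∈ X, (C₂ →_S C₁) ∈ Y} = P(X) · P(Y)`. [cite: Gladkov2024, Lemma 3.1] -/
theorem Pr2W_swap2_mem_prod {T : DTree2 ι} (hV : Valid2 T) {D : Finset ι} (hD : support2 T ⊆ D)
    (X Y : Set (Finset ι)) :
    Pr2W D p {x | (swap2 T x).1 ∈ X ∧ (swap2 T x).2 ∈ Y} = PrW D p X * PrW D p Y := by
  rw [← Pr2W_prod]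
  exact Pr2W_preimage_swap2 p hV hD (X ×ˢ Y)

end Swap

end DTree2

end DecisionTree

end Literature.Probability.Percolation

end
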